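import Literature.Geometry.Riemannian.RicciFlowHeatKernelFn
import HarnessLib

/-!
# Uniform Lipschitz bounds for the heat kernel in the base point, read in a chart
# (Bamler 2020a, §2.3 with Thm. 4.1; auxiliary file)

R. Bamler, *Entropy and heat kernel bounds on a Ricci flow background*, arXiv:2008.07093 (2020a),
uses throughout §5 (Thm. 5.9, Cor. 5.10) that the heat kernel `K(x,t;y,s)` of a Ricci flow on a
closed manifold is smooth in all variables, in particular that `|∇_x K(x,t;·,s)|` is jointly
continuous. The tree's kernel function `K = hflow.heatKernelFn hh hR` (`RicciFlowHeatKernelFn.lean`)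
is known to be `C^∞` in the base point `(x, t)` for a FIXED target point `(y, s)`; this file
supplies the uniformity in the target point needed to pass to joint continuity of `∇_x K`
(`HeatKernelJointGradientContinuity.lean`):

* `IsContMDiffFamilyOn.exists_forall_val_mfderivWithin_symm_le_sq` — for a `C^∞` family of
  metrics `g_σ`, the pulled-back quadratic forms `g_σ(D(φ⁻¹)_c v, D(φ⁻¹)_c v)` of a chart
  `φ = extChartAt I x₀` are bounded near any `(e₀, σ₀)`, `e₀ ∈ φ.target`;
* `IsRicciFlow.exists_forall_ofReal_abs_heatKernelFn_sub_le_mul_edist` — **uniform Lipschitz bound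
  in the base point**: for `a < r < r₂ < T` there is `B` with
  `|K(z,σ;w,r) − K(z',σ;w,r)| ≤ B (π(σ − r₂))^{-1/2} d_{g_σ}(z, z')` for all `σ ∈ (r₂, T]`, `z, z'`,
  `w` (reproduction formula `K(z,σ;w,r) = ∫ K(·,r₂;w,r) dν_{z,σ;r₂}` and the gradient estimate
  behind the strong Feller property,
  `IsRicciFlow.ofReal_abs_integral_sub_integral_le_of_continuous`, i.e. Bamler's Thm. 4.1 at
  `T = 0`);
* `IsRicciFlow.exists_forall_abs_heatKernelFn_symm_add_smul_sub_le` — the same in a chart at `z₀`: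
  `|K(φ⁻¹(e + t v),σ;w,r) − K(φ⁻¹ e,σ;w,r)| ≤ C |t|` for `e` near `φ z₀`, `σ` near `σ₀ ∈ (r₂, T)`,
  `|t|` small, uniformly in `w` (length of chart segments, `edist_symm_le_of_forall_val_le`);
* `IsRicciFlow.contDiffOn_heatKernelFn_symm`, `…differentiableAt_heatKernelFn_symm`,
  `…continuousOn_fderiv_heatKernelFn_symm` — the chart representative `(e, σ) ↦ K(φ⁻¹ e,σ;y,s')`
  is `C^∞` on `φ.target × (s', T)` and its partial derivatives `∂_v` are continuous there.

Everything is proved; no definitions, no named facts. What is NOT here: higher derivatives, the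
joint continuity in the target point (sequel file), non-compact `M`.

## References

* R. H. Bamler, *Entropy and heat kernel bounds on a Ricci flow background*, arXiv:2008.07093
  (2020), §2.3, §4.1 (Thm. 4.1), §5 (Thm. 5.9). [Bamler2020Entropy]
-/

noncomputable section

open Bundle Set Function Filter Manifold MeasureTheory Measure TopologicalSpace
open scoped Manifold ContDiff Topology ENNReal NNReal

namespace Literature.Geometry.Riemannian

open Lorentzian Lorentzian.PseudoRiemannianMetric

/-! ### The pulled-back metrics of a smooth family are locally bounded in a chart -/

section Family

variable {E : Type*} [NormedAddCommGroup E] [NormedSpace ℝ E] [FiniteDimensional ℝ E]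
  {H : Type*} [TopologicalSpace H] {I : ModelWithCorners ℝ E H} [I.Boundaryless]
  {M : Type*} [TopologicalSpace M] [ChartedSpace H M] [IsManifold I ∞ M]
  {g : ℝ → PseudoRiemannianMetric I ∞ E (TangentSpace I : M → Type _)}

/-- **Local bound for the pulled-back metrics of a smooth family in a chart.** For a `C^∞`
family `g_σ` of metrics, a chart `φ = extChartAt I x₀`, a vector `v`, a point `e₀ ∈ φ.target` and
a time `σ₀`, there are `B₁, ε > 0` with `B(e₀, ε) ⊆ φ.target` and
`g_σ(D(φ⁻¹)_c v, D(φ⁻¹)_c v) ≤ B₁²` for `c ∈ B(e₀, ε)`, `|σ − σ₀| < ε` (the coordinate expression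
`∑ᵢⱼ vᵢ vⱼ ĝ_σ,ᵢⱼ(c)` is continuous in `(c, σ)`, `IsContMDiffFamilyOn.contDiffOn_gram_chart`).
[folklore] -/
theorem IsContMDiffFamilyOn.exists_forall_val_mfderivWithin_symm_le_sq
    (hg : IsContMDiffFamilyOn ∞ g univ) (x₀ : M) (v : E) {e₀ : E}
    (he₀ : e₀ ∈ (extChartAt I x₀).target) (σ₀ : ℝ) :
    ∃ B₁ ε : ℝ, 0 < B₁ ∧ 0 < ε ∧ Metric.ball e₀ ε ⊆ (extChartAt I x₀).target ∧
      ∀ c ∈ Metric.ball e₀ ε, ∀ σ ∈ Ioo (σ₀ - ε) (σ₀ + ε),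
        (g σ).val ((extChartAt I x₀).symm c)
          (mfderivWithin 𝓘(ℝ, E) I (extChartAt I x₀).symm (range I) c v)
          (mfderivWithin 𝓘(ℝ, E) I (extChartAt I x₀).symm (range I) c v) ≤ B₁ ^ 2 := by
  classical
  obtain ⟨b⟩ : Nonempty (Module.Basis (Fin (Module.finrank ℝ E)) ℝ E) := ⟨Module.finBasis ℝ E⟩
  set P : E × ℝ → ℝ := fun q ↦ (g q.2).val ((extChartAt I x₀).symm q.1)
      (mfderivWithin 𝓘(ℝ, E) I (extChartAt I x₀).symm (range I) q.1 v)
      (mfderivWithin 𝓘(ℝ, E) I (extChartAt I x₀).symm (range I) q.1 v) with hP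
  -- the Gram coefficients of the family are continuous on `φ.target × ℝ`
  have hG : ∀ i j, ContinuousOn (fun q : E × ℝ ↦ (g q.2).val ((extChartAt I x₀).symm q.1)
      ((trivializationAt E (TangentSpace I) x₀).localFrame b i ((extChartAt I x₀).symm q.1))
      ((trivializationAt E (TangentSpace I) x₀).localFrame b j ((extChartAt I x₀).symm q.1)))
      ((extChartAt I x₀).target ×ˢ univ) := fun i j ↦
    (hg.contDiffOn_gram_chart x₀ b i j).continuousOn
  have hPc : ContinuousOn P ((extChartAt I x₀).target ×ˢ univ) := by
    have hsum : ContinuousOn (fun q : E × ℝ ↦ ∑ i, ∑ j, b.repr v i * b.repr v j *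
        (g q.2).val ((extChartAt I x₀).symm q.1)
          ((trivializationAt E (TangentSpace I) x₀).localFrame b i ((extChartAt I x₀).symm q.1))
          ((trivializationAt E (TangentSpace I) x₀).localFrame b j ((extChartAt I x₀).symm q.1)))
        ((extChartAt I x₀).target ×ˢ univ) :=
      continuousOn_finsetSum _ fun i _ ↦ continuousOn_finsetSum _ fun j _ ↦
        continuousOn_const.mul (hG i j)
    refine hsum.congr fun q hq ↦ ?_
    exact val_mfderivWithin_symm_eq_sum (g q.2) b x₀ hq.1 v
  have hPa : ContinuousAt P (e₀, σ₀) :=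
    hPc.continuousAt (((isOpen_extChartAt_target x₀).prod isOpen_univ).mem_nhds
      ⟨he₀, mem_univ _⟩)
  obtain ⟨δ, hδ, hδP⟩ := Metric.continuousAt_iff.1 hPa 1 one_pos
  obtain ⟨δ', hδ', hball⟩ := Metric.isOpen_iff.1 (isOpen_extChartAt_target x₀) e₀ he₀
  refine ⟨Real.sqrt (|P (e₀, σ₀)| + 1), min δ δ', Real.sqrt_pos.2 (by positivity),
    lt_min hδ hδ', (Metric.ball_subset_ball (min_le_right _ _)).trans hball,
    fun c hc σ hσ ↦ ?_⟩
  have hdist : dist (c, σ) (e₀, σ₀) < δ := by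
    rw [Prod.dist_eq]
    refine max_lt ((Metric.mem_ball.1 hc).trans_le (min_le_left _ _)) ?_
    rw [Real.dist_eq]
    exact (abs_sub_lt_iff.2 ⟨by linarith [hσ.2], by linarith [hσ.1]⟩).trans_le (min_le_left _ _)
  have h1 := hδP hdist
  rw [Real.dist_eq] at h1
  rw [Real.sq_sqrt (by positivity)]
  change P (c, σ) ≤ _
  have h2 := abs_sub_lt_iff.1 h1
  linarith [le_abs_self (P (e₀, σ₀))]

end Family

/-! ### Uniform Lipschitz bounds for the heat kernel in the base point -/

section HeatKernel

variable {m : ℕ} {H : Type*} [TopologicalSpace H]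
  {I : ModelWithCorners ℝ (EuclideanSpace ℝ (Fin m)) H} [I.Boundaryless]
  {M : Type*} [TopologicalSpace M] [ChartedSpace H M] [IsManifold I ∞ M]
  [T2Space M] [CompactSpace M] [SecondCountableTopology M] [MeasurableSpace M] [BorelSpace M]
  [PreconnectedSpace M]
  {h : ℝ → PseudoRiemannianMetric I ∞ (EuclideanSpace ℝ (Fin m)) (TangentSpace I : M → Type _)}
  {cov : ℝ → CovariantDerivative I (EuclideanSpace ℝ (Fin m)) (TangentSpace I : M → Type _)}
  {a T : ℝ}
  (hflow : IsRicciFlow h cov (Icc a T)) (hh : IsContMDiffFamilyOn ∞ h univ)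
  (hR : ∀ r, (h r).IsRiemannian)

/-- `K(z,r₂;w,r) ≤ B` on `M × M` for `a < r < r₂ ≤ T` (continuity on the compact `M × M`).
[cite: Bamler2020Entropy, §2.3] -/
theorem IsRicciFlow.exists_forall_heatKernelFn_le {r r₂ : ℝ} (hr : a < r) (hrr₂ : r < r₂)
    (hr₂T : r₂ ≤ T) :
    ∃ B : ℝ, 0 < B ∧ ∀ z w : M, hflow.heatKernelFn hh hR r₂ z (w, r) ≤ B := by
  have hc : Continuous fun q : M × M ↦ hflow.heatKernelFn hh hR r₂ q.1 (q.2, r) :=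
    (hflow.continuousOn_heatKernelFn hh hR ⟨hr.trans hrr₂, hr₂T⟩).comp_continuous
      (continuous_fst.prodMk (continuous_snd.prodMk continuous_const))
      fun q ↦ ⟨mem_univ _, mem_univ _, hr, hrr₂⟩
  obtain ⟨B, hB⟩ := isCompact_univ.exists_bound_of_continuousOn hc.continuousOn
  refine ⟨max B 1, by positivity, fun z w ↦ ?_⟩
  have h1 := hB (z, w) (mem_univ _)
  rw [Real.norm_eq_abs] at h1
  exact (le_abs_self _).trans (h1.trans (le_max_left _ _))

/-- `x ↦ K(x,t;y,s)` is continuous (`a < s < t ≤ T`). [cite: Bamler2020Entropy, §2.3] -/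
theorem IsRicciFlow.continuous_heatKernelFn_basePoint_slice {t : ℝ} (ht : t ∈ Ioc a T)
    {p : M × ℝ} (hp : p.2 ∈ Ioo a t) : Continuous fun x ↦ hflow.heatKernelFn hh hR t x p :=
  (hflow.continuousOn_heatKernelFn hh hR ht).comp_continuous (continuous_id.prodMk continuous_const)
    fun _ ↦ ⟨mem_univ _, mem_univ _, hp⟩

/-- **Uniform Lipschitz bound for the heat kernel in the base point** (Bamler 2020a, §2.3 with
Thm. 4.1 at `T = 0`): for `a < r < r₂ < T` there is `B > 0` such that for all `σ ∈ (r₂, T]`,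
`z, z', w ∈ M`:
`|K(z,σ;w,r) − K(z',σ;w,r)| ≤ B (π(σ − r₂))^{-1/2} d_{g_σ}(z, z')` — reproduction
`K(z,σ;w,r) = ∫ K(·,r₂;w,r) dν_{z,σ;r₂}` of the bounded continuous datum `K(·,r₂;w,r) ≤ B` and
the Lipschitz bound behind the strong Feller property.
[cite: Bamler2020Entropy, §2.3 and §4.1, Thm. 4.1] -/
theorem IsRicciFlow.exists_forall_ofReal_abs_heatKernelFn_sub_le_mul_edist {r r₂ : ℝ} (hr : a < r)
    (hrr₂ : r < r₂) (hr₂T : r₂ < T) :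
    ∃ B : ℝ, 0 < B ∧ ∀ ⦃σ : ℝ⦄, σ ∈ Ioc r₂ T → ∀ z z' w : M,
      ENNReal.ofReal |hflow.heatKernelFn hh hR σ z (w, r) - hflow.heatKernelFn hh hR σ z' (w, r)| ≤
        ENNReal.ofReal (B * (1 / Real.sqrt (Real.pi * (σ - r₂)))) * (h σ).edist (hR σ) z z' := by
  obtain ⟨B, hB, hle⟩ := hflow.exists_forall_heatKernelFn_le hh hR hr hrr₂ hr₂T.le
  have har₂ : a < r₂ := hr.trans hrr₂
  have hflow' : IsRicciFlow h cov (Icc r₂ T) := hflow.mono (Icc_subset_Icc har₂.le le_rfl)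
  refine ⟨B, hB, fun σ hσ z z' w ↦ ?_⟩
  have hφc : Continuous fun x ↦ hflow.heatKernelFn hh hR r₂ x (w, r) :=
    hflow.continuous_heatKernelFn_basePoint_slice hh hR ⟨har₂, hr₂T.le⟩ ⟨hr, hrr₂⟩
  have hφB : ∀ x, |hflow.heatKernelFn hh hR r₂ x (w, r)| ≤ B := fun x ↦ by
    rw [abs_of_pos (hflow.heatKernelFn_pos hh hR ⟨har₂, hr₂T.le⟩ x ⟨mem_univ _, hr, hrr₂⟩)]
    exact hle x w
  rw [hflow.heatKernelFn_reproduction hh hR har₂ hσ.1 hσ.2 z ⟨hr, hrr₂⟩ w,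
    hflow.heatKernelFn_reproduction hh hR har₂ hσ.1 hσ.2 z' ⟨hr, hrr₂⟩ w]
  exact hflow'.ofReal_abs_integral_sub_integral_le_of_continuous hh hR hr₂T hφc hB hφB hσ z z'

/-- **The uniform Lipschitz bound read along chart directions.** For `a < r < r₂ < σ₀ < T`, a
point `z₀`, `φ = extChartAt I z₀` and a vector `v`, there are `C ≥ 0` and `ε > 0` with
`(σ₀ − ε, σ₀ + ε) ⊆ (r₂, T)`, `B(φ z₀, ε) ⊆ φ.target`, such that for `|σ − σ₀| < ε`,
`e ∈ B(φ z₀, ε)` and `|t| < ε`: `e + t v ∈ φ.target` and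
`|K(φ⁻¹(e + t v),σ;w,r) − K(φ⁻¹ e,σ;w,r)| ≤ C |t|` for ALL `w ∈ M` (the previous bound, and
`d_{g_σ}(φ⁻¹ e, φ⁻¹(e + t v)) ≤ B₁ |t|` by the length of the chart segment,
`edist_symm_le_of_forall_val_le`, with `B₁` from
`IsContMDiffFamilyOn.exists_forall_val_mfderivWithin_symm_le_sq`).
[cite: Bamler2020Entropy, §2.3 and §4.1, Thm. 4.1] -/
theorem IsRicciFlow.exists_forall_abs_heatKernelFn_symm_add_smul_sub_le (z₀ : M)
    (v : EuclideanSpace ℝ (Fin m)) {r r₂ σ₀ : ℝ} (hr : a < r) (hrr₂ : r < r₂) (hr₂σ₀ : r₂ < σ₀)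
    (hσ₀T : σ₀ < T) :
    ∃ C ε : ℝ, 0 ≤ C ∧ 0 < ε ∧ Ioo (σ₀ - ε) (σ₀ + ε) ⊆ Ioo r₂ T ∧
      Metric.ball (extChartAt I z₀ z₀) ε ⊆ (extChartAt I z₀).target ∧
      ∀ ⦃σ : ℝ⦄, σ ∈ Ioo (σ₀ - ε) (σ₀ + ε) →
        ∀ ⦃e : EuclideanSpace ℝ (Fin m)⦄, e ∈ Metric.ball (extChartAt I z₀ z₀) ε →
          ∀ ⦃t : ℝ⦄, |t| < ε → e + t • v ∈ (extChartAt I z₀).target ∧ ∀ w : M,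
            |hflow.heatKernelFn hh hR σ ((extChartAt I z₀).symm (e + t • v)) (w, r) -
                hflow.heatKernelFn hh hR σ ((extChartAt I z₀).symm e) (w, r)| ≤ C * |t| := by
  set φ := extChartAt I z₀ with hφ
  have he₀ : φ z₀ ∈ φ.target := φ.map_source (mem_extChartAt_source z₀)
  obtain ⟨B, hB, hLip⟩ :=
    hflow.exists_forall_ofReal_abs_heatKernelFn_sub_le_mul_edist hh hR hr hrr₂ (hr₂σ₀.trans hσ₀T)
  obtain ⟨B₁, ε₃, hB₁, hε₃, hball, hval⟩ :=
    hh.exists_forall_val_mfderivWithin_symm_le_sq z₀ v he₀ σ₀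
  -- constants
  set L : ℝ := B * (1 / Real.sqrt (Real.pi * ((σ₀ - r₂) / 2))) with hL
  have hL0 : 0 ≤ L := by positivity
  set ε : ℝ := min (ε₃ / (2 * (1 + ‖v‖))) (min ((σ₀ - r₂) / 2) (T - σ₀)) with hε
  have hε0 : 0 < ε := lt_min (by positivity) (lt_min (by linarith) (by linarith))
  have hε₁ : ε ≤ ε₃ / (2 * (1 + ‖v‖)) := min_le_left _ _
  have hε₂ : ε ≤ (σ₀ - r₂) / 2 := (min_le_right _ _).trans (min_le_left _ _)
  have hε₃' : ε ≤ T - σ₀ := (min_le_right _ _).trans (min_le_right _ _)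
  have hvn : (0 : ℝ) ≤ ‖v‖ := norm_nonneg v
  have hεε₃ : ε * (1 + ‖v‖) ≤ ε₃ / 2 := by
    calc ε * (1 + ‖v‖) ≤ ε₃ / (2 * (1 + ‖v‖)) * (1 + ‖v‖) :=
          mul_le_mul_of_nonneg_right hε₁ (by positivity)
      _ = ε₃ / 2 := by field_simp
  have hεle : ε ≤ ε₃ := by nlinarith
  have hIoo : Ioo (σ₀ - ε) (σ₀ + ε) ⊆ Ioo r₂ T := fun σ hσ ↦
    ⟨by linarith [hσ.1], by linarith [hσ.2]⟩
  refine ⟨L * B₁, ε, by positivity, hε0, hIoo, (Metric.ball_subset_ball hεle).trans hball,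
    fun σ hσ e he t ht ↦ ?_⟩
  -- points `e + u • v`, `|u| ≤ |t|`, are within `ε₃` of `φ z₀`
  have hnear : ∀ u : ℝ, |u| ≤ |t| → e + u • v ∈ Metric.ball (φ z₀) ε₃ := by
    intro u hu
    have h1 : ‖e - φ z₀‖ < ε := by rwa [← dist_eq_norm, ← Metric.mem_ball]
    have h2 : |u| * ‖v‖ ≤ ε * ‖v‖ := mul_le_mul_of_nonneg_right (hu.trans ht.le) hvn
    rw [Metric.mem_ball, dist_eq_norm]
    calc ‖e + u • v - φ z₀‖ = ‖(e - φ z₀) + u • v‖ := by abel_nf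
      _ ≤ ‖e - φ z₀‖ + ‖u • v‖ := norm_add_le _ _
      _ = ‖e - φ z₀‖ + |u| * ‖v‖ := by rw [norm_smul, Real.norm_eq_abs]
      _ < ε + ε * ‖v‖ := by linarith
      _ = ε * (1 + ‖v‖) := by ring
      _ ≤ ε₃ / 2 := hεε₃
      _ < ε₃ := by linarith
  have hσ₃ : σ ∈ Ioo (σ₀ - ε₃) (σ₀ + ε₃) := ⟨by linarith [hσ.1], by linarith [hσ.2]⟩
  have hσT : σ ∈ Ioc r₂ T := ⟨(hIoo hσ).1, (hIoo hσ).2.le⟩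
  -- the Lipschitz constant at time `σ` is at most `L`
  have hLσ : B * (1 / Real.sqrt (Real.pi * (σ - r₂))) ≤ L := by
    refine mul_le_mul_of_nonneg_left ?_ hB.le
    refine one_div_le_one_div_of_le (Real.sqrt_pos.2 (by positivity)) (Real.sqrt_le_sqrt ?_)
    exact mul_le_mul_of_nonneg_left (by linarith [hσ.1]) Real.pi_pos.le
  -- one-sided bound along chart segments inside the ball
  have hone : ∀ (e₁ : EuclideanSpace ℝ (Fin m)) (τ : ℝ), 0 ≤ τ →
      (∀ u ∈ Icc (0 : ℝ) τ, e₁ + u • v ∈ Metric.ball (φ z₀) ε₃) → ∀ w : M,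
      |hflow.heatKernelFn hh hR σ (φ.symm (e₁ + τ • v)) (w, r) -
          hflow.heatKernelFn hh hR σ (φ.symm e₁) (w, r)| ≤ L * B₁ * τ := by
    intro e₁ τ hτ hin w
    have h0in : e₁ ∈ Metric.ball (φ z₀) ε₃ := by simpa using hin 0 ⟨le_rfl, hτ⟩
    have hseg : segment ℝ e₁ (e₁ + τ • v) ⊆ φ.target :=
      ((convex_ball (φ z₀) ε₃).segment_subset h0in (hin τ ⟨hτ, le_rfl⟩)).trans hball
    have hD : ∀ u ∈ Icc (0 : ℝ) τ, (h σ).val (φ.symm (e₁ + u • v))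
        (mfderivWithin 𝓘(ℝ, EuclideanSpace ℝ (Fin m)) I φ.symm (range I) (e₁ + u • v) v)
        (mfderivWithin 𝓘(ℝ, EuclideanSpace ℝ (Fin m)) I φ.symm (range I) (e₁ + u • v) v) ≤
        B₁ ^ 2 :=
      fun u hu ↦ hval _ (hin u hu) σ hσ₃
    have hdist := edist_symm_le_of_forall_val_le (h σ) (hR σ) z₀ hτ hB₁.le hseg hD
    have h1 := hLip hσT (φ.symm (e₁ + τ • v)) (φ.symm e₁) w
    rw [PseudoRiemannianMetric.edist_comm] at h1
    have h0 : 0 ≤ L * (τ * B₁) := by positivity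
    have h3 : ENNReal.ofReal |hflow.heatKernelFn hh hR σ (φ.symm (e₁ + τ • v)) (w, r) -
        hflow.heatKernelFn hh hR σ (φ.symm e₁) (w, r)| ≤ ENNReal.ofReal (L * (τ * B₁)) :=
      calc _ ≤ _ := h1
        _ ≤ ENNReal.ofReal L * ENNReal.ofReal (τ * B₁) :=
          mul_le_mul' (ENNReal.ofReal_le_ofReal hLσ) hdist
        _ = ENNReal.ofReal (L * (τ * B₁)) := (ENNReal.ofReal_mul hL0).symm
    have h4 := (ENNReal.ofReal_le_ofReal_iff h0).1 h3
    calc _ ≤ L * (τ * B₁) := h4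
      _ = L * B₁ * τ := by ring
  refine ⟨hball (hnear t le_rfl), fun w ↦ ?_⟩
  rcases le_or_gt 0 t with ht0 | ht0
  · rw [abs_of_nonneg ht0]
    refine hone e t ht0 (fun u hu ↦ hnear u ?_) w
    rw [abs_of_nonneg hu.1, abs_of_nonneg ht0]
    exact hu.2
  · have key := hone (e + t • v) (-t) (neg_nonneg.2 ht0.le) (fun u hu ↦ ?_) w
    · rw [show e + t • v + -t • v = e by
        rw [add_assoc, ← add_smul, add_neg_cancel, zero_smul, add_zero]] at key
      rw [abs_sub_comm, abs_of_neg ht0]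
      exact key
    · rw [add_assoc, ← add_smul]
      refine hnear (t + u) ?_
      rw [abs_of_neg ht0, abs_le]
      exact ⟨by linarith [hu.1], by linarith [hu.2]⟩

/-! ### The chart representative of the kernel in the base point -/

/-- The chart representative `(e, σ) ↦ K(φ⁻¹ e,σ;y,s')`, `φ = extChartAt I z₀`, is `C^∞` on
`φ.target × (s', T)` (`contMDiffOn_heatKernelFn_basePoint` read in the chart).
[cite: Bamler2020Entropy, §2.3] -/
theorem IsRicciFlow.contDiffOn_heatKernelFn_symm (z₀ : M) {s' : ℝ} (hs' : s' ∈ Ioo a T) (y : M) :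
    ContDiffOn ℝ ∞ (fun q : EuclideanSpace ℝ (Fin m) × ℝ ↦
        hflow.heatKernelFn hh hR q.2 ((extChartAt I z₀).symm q.1) (y, s'))
      ((extChartAt I z₀).target ×ˢ Ioo s' T) :=
  contDiffOn_time_chart (k := (⊤ : ℕ∞)) (u := fun t x ↦ hflow.heatKernelFn hh hR t x (y, s'))
    (hflow.contMDiffOn_heatKernelFn_basePoint hh hR hs' y) z₀

/-- `e ↦ K(φ⁻¹ e,σ;y,s')` is differentiable at the points of `φ.target` (`s' < σ < T`).
[cite: Bamler2020Entropy, §2.3] -/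
theorem IsRicciFlow.differentiableAt_heatKernelFn_symm (z₀ : M) {s' : ℝ} (hs' : s' ∈ Ioo a T)
    (y : M) {σ : ℝ} (hσ : σ ∈ Ioo s' T) {e : EuclideanSpace ℝ (Fin m)}
    (he : e ∈ (extChartAt I z₀).target) :
    DifferentiableAt ℝ
      (fun e ↦ hflow.heatKernelFn hh hR σ ((extChartAt I z₀).symm e) (y, s')) e :=
  (((contDiffOn_slice (hflow.contDiffOn_heatKernelFn_symm hh hR z₀ hs' y) hσ).differentiableOn
    (by simp)).differentiableAt ((isOpen_extChartAt_target z₀).mem_nhds he))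

/-- **The partial derivatives of the chart representative are continuous in `(e, σ)`**:
`(e, σ) ↦ ∂_v|_e K(φ⁻¹ ·,σ;y,s')` is continuous on `φ.target × (s', T)` for each fixed target
point `(y, s')` (`contDiffOn_fderiv_slice_apply`). [cite: Bamler2020Entropy, §2.3] -/
theorem IsRicciFlow.continuousOn_fderiv_heatKernelFn_symm (z₀ : M) (v : EuclideanSpace ℝ (Fin m))
    {s' : ℝ} (hs' : s' ∈ Ioo a T) (y : M) :
    ContinuousOn (fun q : EuclideanSpace ℝ (Fin m) × ℝ ↦
        fderiv ℝ (fun e ↦ hflow.heatKernelFn hh hR q.2 ((extChartAt I z₀).symm e) (y, s')) q.1 v)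
      ((extChartAt I z₀).target ×ˢ Ioo s' T) :=
  (contDiffOn_fderiv_slice_apply (isOpen_extChartAt_target z₀) (uniqueDiffOn_Ioo s' T)
    (hflow.contDiffOn_heatKernelFn_symm hh hR z₀ hs' y) v).continuousOn

end HeatKernel

end Literature.Geometry.Riemannian

end
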